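import Mathlib
import HarnessLib
import HarnessLib.Audit
import Literature.InformationTheory.QuantumCodes.BivariateBicycleCodes
import Summits.Ventures.QEC.Census.BB.Claims

/-!
Route: BB144DistanceCertificate

CLOSED (proved) 2026-08-27T02:56:08Z by operator:999:1501189 — reason: proved:Summit.Ventures.QEC.Census.BB144.BB144_12_12_claim_holds. The file is kept as the record of this route; refuted decls are indexed as negative knowledge (`ledger negatives`).

# Route BB144DistanceCertificate — the [[144,12,12]] bivariate-bicycle code has distance exactly 12,
by certificate

It suffices to show X = (no Z-type logical operator of the bivariate-bicycle code QC(x³+y+y²,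
y³+x+x²) on ℤ₁₂ × ℤ₆ = `BB.bb144` has
Hamming weight ≤ 11) ∧ (some Z-type logical operator has weight exactly 12) ∧ (k = n − rk H^X − rk
H^Z = 12). X is the content of a
DISTANCE CERTIFICATE for the printed row [[144,12,12]] of Bravyi–Cross–Gambetta–Maslov–Rall–Yoder
(Nature 627 (2024) Table 1; distance
there "computed by the mixed integer programming approach", no certificate in print): lower bound =
an exhaustive enumeration / UNSAT
certificate re-checked in the kernel, upper bound = one explicit codeword, dimension = a rank
certificate. The route is the LADDER-QEC
rung-Q2 route of cell pub/qec (venture ruling D-0059/D-0061/D-0092): its deciding theorem concludes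
the registered CLAIM leaf
`Summit.Ventures.QEC.BB.BB144_12_12_claim` (`HasParams BB.bb144 144 12 12`), never a summit
Statement (Ventures/QEC has none). No idea card.
Lean: `(∀ v : Literature.InformationTheory.QuantumCodes.BB.Mono 12 6 ⊕
Literature.InformationTheory.QuantumCodes.BB.Mono 12 6 → ZMod 2, Matrix.mulVec
(Literature.InformationTheory.QuantumCodes.BB.bb144).css.HX v = 0 → v ∉
(Literature.InformationTheory.QuantumCodes.BB.bb144).css.rowSpZ → 12 ≤ hammingNorm v) ∧ (∃ v :
Literature.InformationTheory.QuantumCodes.BB.Mono 12 6 ⊕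
Literature.InformationTheory.QuantumCodes.BB.Mono 12 6 → ZMod 2, Matrix.mulVec
(Literature.InformationTheory.QuantumCodes.BB.bb144).css.HX v = 0 ∧ v ∉
(Literature.InformationTheory.QuantumCodes.BB.bb144).css.rowSpZ ∧ hammingNorm v = 12) ∧
(Literature.InformationTheory.QuantumCodes.BB.bb144).k = 12`

## Assembly
Pure logic over three tree lemmas: from `WeightTwelveZLogical` take v; `CSSCode.dZ_eq_of_witness hv
hv' hwt NoZLogicalBelowTwelve : BB.bb144.css.dZ = 12`;
`Summit.Ventures.QEC.BB.numQubits_claims.2.2.2.1 : BB.numQubits 12 6 = 144` (counting, proved);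
`TwelveLogicalQubits144 : BB.bb144.k = 12`; then
`Summit.Ventures.QEC.BB.hasParams_of_dZ` (d = d^Z, Lemma 1, proved) gives `HasParams BB.bb144 144 12
12 = BB144_12_12_claim`. The deciding theorem
`closes` in glue.lean is exactly this, routed through `Assembly` and `Target` so both are in its
cone (lean check rc 0, 0 sorries).

CLOSES_TARGET: closes rung Q2 of Ventures/QEC: Summit.Ventures.QEC.BB.BB144_12_12_claim (D-0061; not the summit Statement) — the deciding theorem of this route concludes that registered leaf (Ventures/QEC: no summit Statement) (class rung: servable and labelled, never counted as concluding the summit Statement).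

Rationale: WHY THIS LINE. The mechanism is the certificate shape of `CSSCode.dZ_eq_of_witness` (tree,
CSS.lean): an explicit logical of weight d plus the universally
checked statement "every logical has weight ≥ d" give d^Z = d, and for every QC(A, B) d = d^Z = d^X
(Lemma 1 of [BravyiEtAl2024],
arXiv:2308.07915 §4, proved in the tree as `BB.Code.d_eq_dZ`), so one side suffices (cell CERT-REQS
C8). The lower bound is the only
expensive conjunct: it is discharged by certificates the cell already holds and a referee has
ROW-SIGNED (certA = search-1 Brouwer–Zimmermann-with-automorphisms enumeration (bz; 3 991 844 064
visits per side, verify_fast replay j257153)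
sha16 7c78eb3404e861c9; certB = search-2 CNF→CaDiCaL→LRAT sha16 f6df93f7c43f9f74, lemma-free
encoding enc-v1; ref-1
ROW-SIGNED 2026-08-26T18:40:03Z, assumes=none), replayed in Lean by type-10's checker
`Summits/Ventures/QEC/Census/CertCheck.lean`
(`checkDistCert` + soundness, p461106) on the flat matrices `BB.bb144.HXFlat/HZFlat` and transported
to `BB.bb144.css` by the landed bridge
`BB.Code.dZ_eq_of_flat` / `cssFlat_dZ` / `cssFlat_k`. Imported from coding theory:
Brouwer–Zimmermann / information-set enumeration
(search-7's information-set variant) and DRAT/LRAT proof logging for the UNSAT side. What the line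
does that print does not: Nature ED Table 1 reports a MIP optimum with no checkable artefact; this
route makes [[144,12,12]] a kernel-checked theorem.

RANKED CRUXES. #0 Target (target) — the printed row — QC(x³+y+y², y³+x+x²) on ℤ₁₂ × ℤ₆ has
parameters [[144, 12, 12]] (n = 144 data qubits, k = 12, distance EXACTLY 12). (why it might fail:
only if the printed MIP distance or dimension is wrong — four independent cell kernels (bruteforce,
CNF/LRAT, Brouwer–Zimmermann, matrix-method) agree on 12 and 12.) [BravyiEtAl2024, arXiv:2308.07915]
#2 NoZLogicalBelowTwelve (crux) — LOWER BOUND — every v with H^X v = 0 and v ∉ rowspace(H^Z) (a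
Z-type logical operator of BB.bb144) has Hamming weight ≥ 12; equivalently no Z-logical of weight ≤
11 exists. Discharged by a kernel-replayed enumeration / UNSAT certificate (certA bz
7c78eb3404e861c9, certB LRAT f6df93f7c43f9f74, or search-7's information-set certificate), via
`CertCheck` soundness + `BB.Code.dZ_eq_of_flat`. PATH OF RECORD (director-qec 2026-08-26 20:45:56Z
P1 / 21:01:06Z; PARTITION v2.5 D7.1): kernel-A Brouwer–Zimmermann with the translation automorphisms
+ parity (d even ⇒ W = 10) — items S1.BZS/S1.BZD (data shards), S7.BZI (information-set witnesses),
10.BZC `Census/CertCheckBZ.lean` (replay + soundness onto `forall_lt_of_bz`, BZAssembly p467446 /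
BrouwerZimmermannBound p466935; one side suffices by `BB.d_eq_of_bzAut_translate` p468260), 12.BZT
(label action + parity + flat transport); kernel-B LRAT trees are not filed for n = 144.
[difficulty: M] (why it might fail: false iff a Z-logical of weight ≤ 11 exists (printed d by MIP,
uncertified); residual risk after two signed certificates = an index-convention slip between the
checker's flat literal and `BB.bb144` (x = S_ℓ ⊗ I_m vs I ⊗ S).) [BravyiEtAl2024, arXiv:2308.07915,
Vardy1997, KapshikarKundu2023]
#3 WeightTwelveZLogical (crux) — UPPER WITNESS — there is an explicit v with H^X v = 0, v ∉
rowspace(H^Z) and |v| = 12 (a weight-12 Z-type logical operator); the certificates list one (certA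
`upper.Z.word`), non-membership in rowspace(H^Z) is a rank / syndrome check decidable on the literal
matrices. [difficulty: S] (why it might fail: false iff d ≥ 13 (every weight-12 kernel word of H^X
is a Z-stabiliser); the listed witness could be mis-transcribed or secretly in rowspace(H^Z) — the
non-membership proof is the delicate part in Lean.) [BravyiEtAl2024, arXiv:2308.07915]
#9 TwelveLogicalQubits144 (support) — DIMENSION — k(BB.bb144) = 144 − rk H^X − rk H^Z = 12 (rk H^X =
rk H^Z = 66 over 𝔽₂), by a rank certificate (type-02's Census/RankCert.lean p462257) transported
with `BB.Code.cssFlat_k`; equivalently k = 2·dim(ker A ∩ ker B) (Lemma 1). [difficulty: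
provable-now] [BravyiEtAl2024, arXiv:2308.07915, CalderbankShor1996]

TWO-LAYER PLAN. Foreseen split of NoZLogicalBelowTwelve only if the monolithic kernel replay is too
heavy: NoZLogicalBelowTwelve ⇐ (checker soundness: `checkDistCert cert = true → ∀ v, …` on the flat
code, type-10 CertCheck) → (the data fact `checkDistCert cert = true`, by `decide +kernel` in ≤
400-line chunk files, search-7 emitter; or the information-set variant, one light file per side) →
NoZLogicalBelowTwelve via `BB.Code.dZ_eq_of_flat`; k ≤ 3 children, depth 1. Nothing filed now.

KILL CRITERIA. A kernel-checked Z-logical (or X-logical, d^X = d^Z) of weight ≤ 11 refutes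
NoZLogicalBelowTwelve and the CLAIM itself (route closes refuted:NoZLogicalBelowTwelve and the
census row becomes a DISCREPANCY finding against Nature 627 Table 1); a proof that rk H^X ≠ 66
refutes TwelveLogicalQubits144 likewise. A proof of `BB144_12_12_claim` landed by any other cell
file (e.g. search-7's CertNative/Kernel files + Distance.lean discharging the claim directly) moots
the route — it is then closed superseded with the discharging theorem named.

NOT DECOMPOSED YET. The checker-soundness / data-fact split of the lower bound (Two-layer plan), the
X-side mirror statements (unnecessary: d^X = d^Z is a tree theorem), and the per-chunk leaf theorems
of the kernel replay — all are prover-side packaging below item level (attached with --supports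
NoZLogicalBelowTwelve), never items.

CHEAPEST FALSIFIER. Run any distance tool on the H^X = [A|B], H^Z = [Bᵀ|Aᵀ] matrices of BB.bb144 and
look for a logical of weight ≤ 11. Done inside the cell before filing: certA = Brouwer–Zimmermann
with the translation automorphism group, 3 991 844 064 visits per side (orbit lemma p461461); certB
= CNF→CaDiCaL UNSAT with LRAT proof, lemma-free enc-v1; third method HiGHS MILP (search-4) agrees;
BP+OSD with printed settings corrects every error of weight ≤ 5 (search-6 exhaustive, FINDINGS R4-1)
⇒ d ≥ 11 independently; ref-1 replayed/re-derived both certificates and ROW-SIGNED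
(2026-08-26T18:40:03Z, assumes=none).

NUMBERS. n = 144 = 2·12·6; k = 12; d = d^X = d^Z = 12 (Nature 627 Table 1); rk H^X = rk H^Z = 66;
kernel path of record for d = 12 = the kernel-B leaf chain (search-2 cubes → search-10 leaf files →
type-11 LRATBridge) or the bz-in-Lean checker 10.L5 (type-10 + type-07 BrouwerZimmermannBound +
search-7 CertInfoSet); the gross code is the grant-milestone row.

DEFINITION REQUESTS. None: `BB.Code`, `BB.bb144`, `CSSCode.dZ/dX/k/rowSpZ`, `hammingNorm`,
`HasParams`, the flat bridge `BB.Code.cssFlat` (+ `dZ_eq_of_flat`, `cssFlat_k`) and the checker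
`Census/CertCheck.lean` are all in the tree. Cite fact wanted: none (BravyiEtAl2024 is in
references.bib; the claim decl carries the locators).

Novelty: Searches (2026-08-26): lit search "bivariate bicycle code distance" (6 local docs: arXiv:2308.07915,
2502.20189, 2510.06495, 2411.03302, 2605.14173, 2503.22071; 13 remote merged, OpenAlex/S2
rate-limited); lit galaxy search "bivariate bicycle|[[144,12,12]]|BB code distance" --star all
(panama 0, pdf 5 decoder papers, crabby 0); cell literature seats lit-3 (LIT-3-CONSTRUCTIONS.md
v1.1: "how d was established in print" = MILP for all five BB rows, Nature ED Table 1 caption p0011)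
and lit-1 (LIT-1-REGISTER.md: families with proved d vs exhaustive/LP vs upper-bound-only).
Nearest prior art found: BravyiEtAl2024 = arXiv:2308.07915 (Nature 627, 778) Table 1 / ED Table 1 —
the parameters by mixed-integer programming (their ref. 68), no certificate; arXiv:2502.20189 Table
I reprints the row; QDistRnd-style randomized upper bounds (Pryadko et al.) for related two-block
codes (lit-3 A2/A3).
Delta: an INDEPENDENT certificate that QC(x³+y+y², y³+x+x²) on ℤ₁₂ × ℤ₆ has distance exactly 12 and
k = 12 on the typed literature object BB.bb144, checked by the Lean kernel with standard axioms only
(KERNEL-std: decide / proof terms, no compiled-reflection axiom), from two independent certificate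
kernels (certA 7c78eb3404e861c9 (bz_aut) ∧ certB f6df93f7c43f9f74 (enc-v1 LRAT)) with referee
signatures — print has solver (MIP) output only. PRIOR ART (director 20:47:46Z, FINDINGS PA-1):
Lean-QEC (Ehatamm–Lee–Wu–Tao, arXiv:2605.16523, May 2026; repo VerifiedQC/Lean-QEC) proves BB72 d ≥
6 by bv_decide o  [refs: 2308.07915, 2502.20189, 2605.16523, BravyiEtAl2024]

Barriers (technique_class: certified-computation, enumeration, unsat-cert): - technique_class: certified-computation, enumeration, unsat-cert
- Literature.Barriers.Ventures: no catalogued barrier directory exists for Ventures (ls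
lean/Literature/Barriers/ has none); the technique-class barrier is NP-hardness of minimum distance
—
`Literature.InformationTheory.QuantumCodes.MinimumDistanceHardness.Vardy1997_minimumDistance_isNPComplete`
and `KapshikarKundu2023_quantumMinimumDistance_isNPHard` (tree, named facts): they bound the
asymptotic cost of a uniform algorithm, not a fixed instance — n = 144, w ≤ 11 is a fixed finite
instance, enumerated with symmetry reduction / UNSAT-certified and kernel-replayed; the route does
not claim a method that scales.
- Negatives index: empty for Ventures/QEC at filing (ledger negatives --problem Ventures consulted
by the cell's refuter seats; no refuted statement about BB codes).

History (route lifecycle, newest last):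
- 2026-08-27T02:56:09Z · CLOSED proved — proved:Summit.Ventures.QEC.Census.BB144.BB144_12_12_claim_holds (operator:999:1501189)

sub-problem: QEC · status: closed(proved) · opened operator:999:761067 2026-08-26T22:03:51Z · rev 0 · ledger route-Ventures-BB144DistanceCertificate
GENERATED by the gate from the ledger (D-0016/17). Provers cite these decls: `theorem foo : Summit.Ventures.QEC.Theses.BB144DistanceCertificate.<Decl> := …` in Summits/Ventures/QEC/Theorems/<Name>.lean.
-/

namespace Summit.Ventures.QEC.Theses.BB144DistanceCertificate

open scoped BigOperators Topology Manifold Classical MeasureTheory ProbabilityTheory Matrix InnerProductSpace ComplexConjugate ContinuousMap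
open Filter Set Function TopologicalSpace MeasureTheory

-- H21.Audit: Ventures rung route — no summit Statement decl; the expected conclusion is the closer leaf tagged below
attribute [summit_statement] _root_.Summit.Ventures.QEC.BB.BB144_12_12_claim

/-- item stmt-Ventures-19771 · target · rank 0 · closed · proved by Summit.Ventures.QEC.Census.BB144.BB144_12_12_claim_holds (prover) · by operator
why it might fail: only if the printed MIP distance or dimension is wrong — four independent cell kernels (bruteforce, CNF/LRAT, Brouwer–Zimmermann, matrix-method) agree on 12 and 12.
sources: BravyiEtAl2024, arXiv:2308.07915
[target] the printed row — QC(x³+y+y², y³+x+x²) on ℤ₁₂ × ℤ₆ has parameters [[144, 12, 12]] (n = 144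
data qubits, k = 12, distance EXACTLY 12). -/
@[route_item "route-Ventures-BB144DistanceCertificate"]
def Target : Prop :=
  Summit.Ventures.QEC.BB.BB144_12_12_claim

-- `Target` holds: proved by `Summit.Ventures.QEC.Census.BB144.BB144_12_12_claim_holds` (its module imports this route file, so no `_holds` link can be stated here).

/-- item stmt-Ventures-19772 · crux · rank 2 · closed · proved by Summit.Ventures.QEC.Census.BB144.noZLogicalBelowTwelve_proof (prover) · by operator
why it might fail: false iff a Z-logical of weight ≤ 11 exists (printed d by MIP, uncertified); residual risk after two signed certificates = an index-convention slip between the checker's flat literal and `BB.bb144` (x = S_ℓ ⊗ I_m vs I ⊗ S).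
sources: BravyiEtAl2024, arXiv:2308.07915, Vardy1997, KapshikarKundu2023
[crux] LOWER BOUND — every v with H^X v = 0 and v ∉ rowspace(H^Z) (a Z-type logical operator of
BB.bb144) has Hamming weight ≥ 12; equivalently no Z-logical of weight ≤ 11 exists. Discharged by a
kernel-replayed enumeration / UNSAT certificate (certA bz 7c78eb3404e861c9, certB LRAT
f6df93f7c43f9f74, or search-7's information-set certificate), via `CertCheck` soundness +
`BB.Code.dZ_eq_of_flat`. PATH OF RECORD (director-qec 2026-08-26 20:45:56Z P1 / 21:01:06Z; PARTITION
v2.5 D7.1): kernel-A Brouwer–Zimmermann with the translation automorphisms + parity (d even ⇒ W =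
10) — items S1.BZS/S1.BZD (data shards), S7.BZI (information-set witnesses), 10.BZC
`Census/CertCheckBZ.lean` (replay + soundness onto `forall_lt_of_bz`, BZAssembly p467446 /
BrouwerZimmermannBound p466935; one side suffices by `BB.d_eq_of_bzAut_translate` p468260), 12.BZT
(label action + parity + flat transport); kernel-B LRAT trees are not filed for n = 144.
[difficulty: M] -/
@[route_item "route-Ventures-BB144DistanceCertificate"]
def NoZLogicalBelowTwelve : Prop :=
  ∀ v : Literature.InformationTheory.QuantumCodes.BB.Mono 12 6 ⊕ Literature.InformationTheory.QuantumCodes.BB.Mono 12 6 → ZMod 2, Matrix.mulVec (Literature.InformationTheory.QuantumCodes.BB.bb144).css.HX v = 0 → v ∉ (Literature.InformationTheory.QuantumCodes.BB.bb144).css.rowSpZ → 12 ≤ hammingNorm v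

-- `NoZLogicalBelowTwelve` holds: proved by `Summit.Ventures.QEC.Census.BB144.noZLogicalBelowTwelve_proof` (its module imports this route file, so no `_holds` link can be stated here).

/-- item stmt-Ventures-19773 · crux · rank 3 · closed · proved by Summit.Ventures.QEC.Census.BB144.weightTwelveZLogical_proof (prover) · by operator
why it might fail: false iff d ≥ 13 (every weight-12 kernel word of H^X is a Z-stabiliser); the listed witness could be mis-transcribed or secretly in rowspace(H^Z) — the non-membership proof is the delicate part in Lean.
sources: BravyiEtAl2024, arXiv:2308.07915
[crux] UPPER WITNESS — there is an explicit v with H^X v = 0, v ∉ rowspace(H^Z) and |v| = 12 (a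
weight-12 Z-type logical operator); the certificates list one (certA `upper.Z.word`), non-membership
in rowspace(H^Z) is a rank / syndrome check decidable on the literal matrices. [difficulty: S] -/
@[route_item "route-Ventures-BB144DistanceCertificate"]
def WeightTwelveZLogical : Prop :=
  ∃ v : Literature.InformationTheory.QuantumCodes.BB.Mono 12 6 ⊕ Literature.InformationTheory.QuantumCodes.BB.Mono 12 6 → ZMod 2, Matrix.mulVec (Literature.InformationTheory.QuantumCodes.BB.bb144).css.HX v = 0 ∧ v ∉ (Literature.InformationTheory.QuantumCodes.BB.bb144).css.rowSpZ ∧ hammingNorm v = 12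

-- `WeightTwelveZLogical` holds: proved by `Summit.Ventures.QEC.Census.BB144.weightTwelveZLogical_proof` (its module imports this route file, so no `_holds` link can be stated here).

/-- item stmt-Ventures-19774 · support · rank 9 · closed · proved by Summit.Ventures.QEC.Theorems.TwelveLogicalQubits144_proof (prover) · by operator
sources: BravyiEtAl2024, arXiv:2308.07915, CalderbankShor1996
[support] DIMENSION — k(BB.bb144) = 144 − rk H^X − rk H^Z = 12 (rk H^X = rk H^Z = 66 over 𝔽₂), by a
rank certificate (type-02's Census/RankCert.lean p462257) transported with `BB.Code.cssFlat_k`;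
equivalently k = 2·dim(ker A ∩ ker B) (Lemma 1). [difficulty: provable-now] -/
@[route_item "route-Ventures-BB144DistanceCertificate"]
def TwelveLogicalQubits144 : Prop :=
  (Literature.InformationTheory.QuantumCodes.BB.bb144).k = 12

-- `TwelveLogicalQubits144` holds: proved by `Summit.Ventures.QEC.Theorems.TwelveLogicalQubits144_proof` (its module imports this route file, so no `_holds` link can be stated here).

/-- item stmt-Ventures-19775 · assembly · rank 1 · closed · proved by Summit.Ventures.QEC.Theorems.bb144DistanceCertificate_assembly_proof (prover) · by operator
sources: BravyiEtAl2024
[assembly] NoZLogicalBelowTwelve → WeightTwelveZLogical → TwelveLogicalQubits144 → the [[144,12,12]]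
claim. -/
@[route_item "route-Ventures-BB144DistanceCertificate"]
def Assembly : Prop :=
  NoZLogicalBelowTwelve → WeightTwelveZLogical → TwelveLogicalQubits144 → Summit.Ventures.QEC.BB.BB144_12_12_claim

-- `Assembly` holds: proved by `Summit.Ventures.QEC.Theorems.bb144DistanceCertificate_assembly_proof` (its module imports this route file, so no `_holds` link can be stated here).

/-! D-0027 §2.1 — DECIDING THEOREM (planner-authored via `route open/edit --closes-file`; by operator:999:761067 2026-08-26T22:03:51Z) — ARCHIVED: route closed (proved) 2026-08-27T02:56:08Z; kept so importers keep building: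
its hypotheses are this route's items and its conclusion the registered leaf `Summit.Ventures.QEC.BB.BB144_12_12_claim` (rung Q2, D-0061) (glue_lint), and it elaborates with this file. -/

/-- **Deciding theorem of route BB144DistanceCertificate** (Ventures/QEC rung Q2; D-0027 §2.1, D-0059/D-0061/D-0092:
closes_target = the registered CLAIM leaf `Summit.Ventures.QEC.BB.BB144_12_12_claim`, never a summit Statement).
Lower bound + explicit weight-d witness ⇒ d^Z(BB.bb144) = d (`CSSCode.dZ_eq_of_witness`); n by counting
(`numQubits_claims.2.2.2.1`); k (support item); then `hasParams_of_dZ` (Lemma 1 of Bravyi et al.: `d = d^Z`, tree theorem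
`BB.Code.d_eq_dZ`). Routed THROUGH `Assembly` and `Target` so both decls are in the cone of `closes`; every binder load-bearing;
fully qualified names, no `open`. -/
@[closes "route-Ventures-BB144DistanceCertificate"] theorem closes (hL : NoZLogicalBelowTwelve) (hU : WeightTwelveZLogical) (hK : TwelveLogicalQubits144) :
    Summit.Ventures.QEC.BB.BB144_12_12_claim := by
  have hA : Assembly := fun hL' hU' hK' => by
    obtain ⟨v, hv, hv', hwt⟩ := hU'
    exact Summit.Ventures.QEC.BB.hasParams_of_dZ Summit.Ventures.QEC.BB.numQubits_claims.2.2.2.1 hK'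
      ((Literature.InformationTheory.QuantumCodes.BB.bb144).css.dZ_eq_of_witness hv hv' hwt hL')
  have hT : Target := hA hL hU hK
  exact hT

end Summit.Ventures.QEC.Theses.BB144DistanceCertificate
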